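import Mathlib.Analysis.Calculus.ContDiff.Defs
import Mathlib.Analysis.SpecialFunctions.Log.Basic
import Mathlib.Analysis.SpecialFunctions.Pow.Real
import Mathlib.MeasureTheory.Integral.IntervalIntegral.Basic
import HarnessLib

/-!
# Conrey–Farmer–Kwan–Lin–Turnage-Butterbaugh (2025), Theorem 1: Levinson's method yields
# `κ > 2θ/3 > 0` for every short mollifier length `θ`, with a variationally chosen `Q`

LABEL (cell `landau-siegel`, §C literature harvest, topic r5 = mollifier-optimisation numerics;
bears_on F-S3 §C, START-HERE for §B-det "detector weights"): the closed-form main-term functional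
`c(P,Q,R)` of the Conrey–Levinson method and the printed statement that an OPTIMAL choice of the
linear combination of derivatives `Q` makes the method positive at every length `θ > 0`. This is a
statement about a real-variable variational problem; the arithmetic input (that the mollified-moment
asymptotic holds at length `θ`, known for `θ < 4/7`, Conrey 1989) is NOT part of it. «The programme
SEARCHES and TYPES; no claim about Landau–Siegel zeros, Theorems 1–2 of arXiv:2211.02515 or a
repaired Margin232 until a kernel theorem says so.»

Topic `Literature/NumberTheory/LFunctions` (namespace `Literature.NumberTheory.LFunctions`, objects in
the sub-namespace `ShortMollifiers`). STATEMENT LAYER (D-0014): ONE named fact (Theorem 1) over two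
honest definitions (`conreyLevinsonConst` = the paper's `c(P,Q,R)` at length `θ`,
`levinsonProportion` = `κ = 1 − log c / R`). Related tree material (cited, not re-declared): the
specialised constant `conrey1989Const` and the proved Levinson framework
`levinson_criticalLineProportion_ge` (`ZeroCountingConreyProofs.lean`, `LevinsonMethodConditional.lean`),
which turn «the asymptotic (2.1) holds with constant `c`» into `κ ≥ 1 − log c/R` for `ζ`.

## What the source prints (held text `paper:arxiv-2508.11108`, corpus-tex chunks p0003–p0006,
## p0010–p0011, read 2026-08-26)

J. B. Conrey, D. W. Farmer, C.-H. Kwan, Y. Lin, C. L. Turnage-Butterbaugh, *Short mollifiers of the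
Riemann zeta-function*, arXiv:2508.11108 (2025) [ConreyFarmerKwanLinTurnageButterbaugh2025].

§2.1 (p0006): «Let `P` be a polynomial satisfying `P(0) = 0`, `P(1) = 1`, `Q` a polynomial
satisfying `Q(0) = 1` and `Q′(y) = Q′(1−y)`, and let `R > 0` be any constant. According to [Con89],
if `θ > 0` is an admissible constant such that the asymptotic formula
`(1/T)∫₀ᵀ |Q(−(1/L) d/ds)ζ(a+it) M(a+it,P)|² dt ∼ c(P,Q,R)`   (2.1)
holds as `T → ∞`, where `a = 1/2 − R/log(T/2π)`, … then the proportion of zeros of `ζ(s)` on the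
critical line is at least `κ := 1 − log c(P,Q,R)/R`. By [Con89], the constant `c(P,Q,R)` is given by
`1 + (1/θ) ∫₀¹∫₀¹ (w(y)P′(x) + θ w′(y)P(x))² dx dy`, where `w(y) := e^{Ry} Q(y)`. To simplify the
exposition … we adopt Levinson's original choice `P(x) = x`. Also, observe that the class of
admissible functions `Q` can be extended to include all continuously differentiable (`C¹`)
functions `Q : [0,1] → ℝ` with `Q(0) = 1` and `Q(y) + Q(1−y) = 1` [(2.6)].»

> **Theorem 1.** There exists `θ₀ > 0` such that whenever `θ ∈ (0, θ₀)`, there exists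
> `Q = Q_θ ∈ C¹[0,1]` satisfying (2.6) such that `κ` defined in (2.3) satisfies `κ > 2θ/3 > 0`.

«The constant `θ₀` is explicitly computable. In fact, our numerical evidence suggests the following
explicit bound for any `0 < θ ≤ 1/2`: `κ > (2/3)θ`.» Proof (§§3–5): `R = θ⁻¹√(3/5)`, the
Euler–Lagrange equation for `K(S)`, and an explicit `S_R`. §6 table (Mathematica): `κ(2/3) = 0.364…`,
`κ(1/2) = 0.334…`, `κ(1/4) = 0.176…`, `κ(1/8) = 0.0854…`, `κ(5/54) = 0.0632…`, `κ(1/100) = 0.00682…`.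

## Lean rendering / design choices (audit notes for ls-lit-ref)

* `c(P,Q,R)` depends on `θ` (the paper suppresses it): `conreyLevinsonConst θ R P Q`, with `P′`, `w′`
  as `deriv` (for the `C¹` data of the theorem these are the classical derivatives on `(0,1)`; the
  integrals are interval integrals over `[0,1]`, insensitive to the endpoints).
* `Q ∈ C¹[0,1]`: rendered as a globally `C¹` function `Q : ℝ → ℝ` (`ContDiff ℝ 1 Q`) whose
  restriction satisfies (2.6) on `[0,1]` — every `C¹` function on `[0,1]` with (2.6) extends to such a
  `Q` (reflect by `Q(y) = 1 − Q(1−y)`), so the existential statement is unchanged.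
* `P(x) = x` as in the paper's proof (`id`), `R = θ⁻¹ √(3/5)` ((2.9), the paper's standing
  simplification under which Theorem 1 is proved) is recorded INSIDE the existential as the paper
  does («there exists `Q = Q_θ`» for that `R`); we state `∃ R > 0, ∃ Q` to type exactly the displayed
  sentence (which does not fix `R`) while the docstring records the witness `R = θ⁻¹√(3/5)`.
* NOT typed: the admissibility of `θ` (arithmetic), the conjectured bound `κ > (2/3)θ` on
  `(0, 1/2]` (numerical evidence only), Proposition 1 (`Q_θ → Q_∞` pointwise) and the §6 table
  (uncertified floating point).

## References

* J. B. Conrey, D. W. Farmer, C.-H. Kwan, Y. Lin, C. L. Turnage-Butterbaugh, arXiv:2508.11108 (2025):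
  §2.1 (2.1)–(2.6), Theorem 1, §§3–6. [ConreyFarmerKwanLinTurnageButterbaugh2025]
* J. B. Conrey, J. reine angew. Math. 399 (1989) 1–26, Thm. 2 (the constant `c(P,Q,R,θ)`) — tree:
  `ZeroCountingConreyProofs.lean` (`conrey1989Const`), `LevinsonMethodConditional.lean`. [Conrey1989]
-/

noncomputable section

open Real MeasureTheory intervalIntegral Set

namespace Literature.NumberTheory.LFunctions

namespace ShortMollifiers

/-- Conrey's mean-square constant at mollifier length `θ`, shift `R`, mollifier polynomial `P` and
detector `Q` ([Con89, Thm 2] in the form (2.4) of the paper):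
`c(P,Q,R) = 1 + (1/θ) ∫₀¹∫₀¹ (w(y) P′(x) + θ w′(y) P(x))² dx dy`, `w(y) = e^{Ry} Q(y)`
(inner integral `dx`, outer `dy`; `P′ = deriv P`, `w′ = deriv w`).
[cite: ConreyFarmerKwanLinTurnageButterbaugh2025, §2.1 (2.4)–(2.5)] -/
def conreyLevinsonConst (θ R : ℝ) (P Q : ℝ → ℝ) : ℝ :=
  1 + θ⁻¹ * ∫ y in (0 : ℝ)..1, ∫ x in (0 : ℝ)..1,
    (exp (R * y) * Q y * deriv P x + θ * deriv (fun u ↦ exp (R * u) * Q u) y * P x) ^ 2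

/-- The Levinson–Conrey proportion `κ := 1 − log c(P,Q,R) / R` ((2.3) of the paper; the lower
bound for the proportion of critical zeros WHEN the asymptotic (2.1) holds at length `θ`).
[cite: ConreyFarmerKwanLinTurnageButterbaugh2025, §2.1 (2.3)] -/
def levinsonProportion (θ R : ℝ) (P Q : ℝ → ℝ) : ℝ :=
  1 - Real.log (conreyLevinsonConst θ R P Q) / R

/-- The admissible detectors (2.6): `Q ∈ C¹`, `Q(0) = 1`, `Q(y) + Q(1 − y) = 1` on `[0,1]`.
[cite: ConreyFarmerKwanLinTurnageButterbaugh2025, §2.1 (2.6)] -/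
def IsAdmissibleQ (Q : ℝ → ℝ) : Prop :=
  ContDiff ℝ 1 Q ∧ Q 0 = 1 ∧ ∀ y ∈ Icc (0 : ℝ) 1, Q y + Q (1 - y) = 1

/-- Unfolding lemma for `levinsonProportion`. [cite: ConreyFarmerKwanLinTurnageButterbaugh2025, §2.1 (2.3)] -/
theorem levinsonProportion_def (θ R : ℝ) (P Q : ℝ → ℝ) :
    levinsonProportion θ R P Q = 1 - Real.log (conreyLevinsonConst θ R P Q) / R := rfl

/-- An admissible `Q` has `Q(1) = 0` and `Q(1/2) = 1/2` (from `Q(0) = 1` and the symmetry (2.6) at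
`y = 0`, `y = 1/2`). [cite: ConreyFarmerKwanLinTurnageButterbaugh2025, §2.1 (2.6)] -/
theorem IsAdmissibleQ.eval_one_and_half {Q : ℝ → ℝ} (h : IsAdmissibleQ Q) :
    Q 1 = 0 ∧ Q (1 / 2) = 1 / 2 := by
  obtain ⟨-, h0, hsym⟩ := h
  have h1 := hsym 0 (by norm_num)
  have h2 := hsym (1 / 2) (by norm_num)
  norm_num at h1 h2
  constructor <;> linarith

end ShortMollifiers

open ShortMollifiers

/-- **Conrey–Farmer–Kwan–Lin–Turnage-Butterbaugh 2025, Theorem 1** (Levinson's method is positive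
for arbitrarily short mollifiers, with a variational detector). There is `θ₀ > 0` such that for
every `θ ∈ (0, θ₀)` there are `R > 0` (the paper takes `R = θ⁻¹ √(3/5)`, (2.9)) and an admissible
`Q = Q_θ` (`C¹`, `Q(0) = 1`, `Q(y) + Q(1−y) = 1` on `[0,1]`) with, for Levinson's `P(x) = x`,
`κ = 1 − log c(P,Q,R)/R > 2θ/3 > 0`, where
`c(P,Q,R) = 1 + θ⁻¹∫₀¹∫₀¹ (w(y)P′(x) + θw′(y)P(x))² dx dy`, `w = e^{Ry}Q` (Conrey's constant). By
[Con89] this `κ` is a lower bound for the proportion of critical zeros of `ζ` whenever the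
mollified-moment asymptotic (2.1) holds at length `θ` (known for `θ < 4/7`; that arithmetic input is
not part of this statement). Status: preprint claim, unrefereed
[claim: ConreyFarmerKwanLinTurnageButterbaugh2025, status: under-review] (named fact; the paper's numerics suggest
`κ > (2/3)θ` for all `0 < θ ≤ 1/2`, not asserted here). [cite: ConreyFarmerKwanLinTurnageButterbaugh2025, Theorem 1] -/
def cfklt2025_shortMollifiers_theorem1 : Prop :=
  ∃ θ₀ : ℝ, 0 < θ₀ ∧ ∀ θ : ℝ, 0 < θ → θ < θ₀ →
    ∃ R : ℝ, 0 < R ∧ ∃ Q : ℝ → ℝ, IsAdmissibleQ Q ∧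
      2 * θ / 3 < levinsonProportion θ R (fun x ↦ x) Q

end Literature.NumberTheory.LFunctions
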